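import Summits.Ventures.YMGap.FlowData.ChebyshevRecurrenceStability

/-!
# Venture YMGap, track Y3 FLOW-DATA — Chebyshev polynomials of a perturbed operator (lineage C «x2r», step R1: the table-rounding term)

HONEST FRAMING: venture file of the cell `pub-ymgap` (QuantumFields programme), track Y3, lineage C (engine-3; kernel «x2r», method note
`engine/sce/results-Y3/onesite2/code-x2r/X2R-METHOD.md` § «The untruncated plaquette operator applied to a vector»: the term
`‖p_K(y) − p_K(ŷ)‖ ≤ Σ|c_k| k(k+1)·2‖y − ŷ‖` for the 44-digit rounding `ŷ` of the matrix of `y`).  Pure linear algebra; NO lattice number,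
nothing about limits or a mass gap.

Corollary of `ChebyshevRecurrenceStability`: if `A` and `B` are two operators whose Chebyshev polynomials `T_m(A)`, `T_m(B)` are contractions
(e.g. symmetric with `‖A‖, ‖B‖ ≤ 1`) and `‖B v − A v‖ ≤ δ‖v‖`, then `u_k = T_k(B)φ` is a perturbed `A`-recurrence with local errors
`e₁ = (B − A)φ`, `e_{k+2} = 2(B − A)u_{k+1}` of norm `≤ 2δ‖φ‖`, hence ★ `norm_aeval_T_sub_aeval_T_le`: `‖T_k(B)φ − T_k(A)φ‖ ≤ δ·k(k+1)·‖φ‖`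
and ★ `norm_chebSum_aeval_sub_le`: `‖Σ_{k≤K} c_k T_k(B)φ − Σ_{k≤K} c_k T_k(A)φ‖ ≤ δ‖φ‖ · Σ_{k≤K} |c_k| k(k+1)`; symmetric-contraction instances
`…_of_isSymmetric`.  References: NIST DLMF §3.11(ii) [cite: DLMF, 3.11(ii)]; Higham 2002 Ch. 3 (context) [cite: Higham2002, Ch. 3].
-/

noncomputable section

open Finset Polynomial Polynomial.Chebyshev
open scoped BigOperators

namespace Summit.Ventures.YMGap.FlowData.ChebyshevRecurrenceStability

section Normed

variable {E : Type*} [NormedAddCommGroup E] [NormedSpace ℝ E]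

/-- The sequence `k ↦ T_k(Y) φ` satisfies the three-term recurrence. [cite: DLMF, 3.11(ii)] -/
theorem aeval_T_add_two_apply (Y : Module.End ℝ E) (φ : E) (k : ℕ) :
    aeval Y (Chebyshev.T ℝ ((k + 2 : ℕ) : ℤ)) φ =
      (2 : ℝ) • Y (aeval Y (Chebyshev.T ℝ ((k + 1 : ℕ) : ℤ)) φ) - aeval Y (Chebyshev.T ℝ (k : ℤ)) φ := by
  rw [← aeval_two_mul_X_mul_sub_apply]
  congr 2
  have := Chebyshev.T_add_two ℝ (k : ℤ)
  push_cast at this ⊢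
  exact this

/-- ★ **Chebyshev polynomials of a perturbed operator.**  If `T_m(A)` and `T_m(B)` are contractions for all `m` and `‖B v − A v‖ ≤ δ‖v‖`,
then `‖T_k(B)φ − T_k(A)φ‖ ≤ δ · k(k+1) · ‖φ‖`. [cite: DLMF, 3.11(ii)] -/
theorem norm_aeval_T_sub_aeval_T_le (A B : Module.End ℝ E)
    (hA : ∀ (m : ℕ) (v : E), ‖aeval A (Chebyshev.T ℝ m) v‖ ≤ ‖v‖) (hB : ∀ (m : ℕ) (v : E), ‖aeval B (Chebyshev.T ℝ m) v‖ ≤ ‖v‖)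
    {δ : ℝ} (hAB : ∀ v, ‖B v - A v‖ ≤ δ * ‖v‖) (φ : E) (k : ℕ) :
    ‖aeval B (Chebyshev.T ℝ k) φ - aeval A (Chebyshev.T ℝ k) φ‖ ≤ δ * ((k : ℝ) * (k + 1)) * ‖φ‖ := by
  -- local errors of `u_k = T_k(B)φ` seen as a perturbed `A`-recurrence
  set u : ℕ → E := fun k => aeval B (Chebyshev.T ℝ k) φ with hu
  set e : ℕ → E := fun k => match k with
    | 0 => 0
    | 1 => B φ - A φ
    | (j + 2) => (2 : ℝ) • (B (u (j + 1)) - A (u (j + 1))) with he_def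
  have hδ : 0 ≤ δ * ‖φ‖ ∨ φ = 0 := by
    by_cases hφ : φ = 0
    · exact Or.inr hφ
    · left
      have h := hAB φ
      have : 0 ≤ δ := by
        by_contra hneg
        have hneg' : δ < 0 := lt_of_not_ge hneg
        have : δ * ‖φ‖ < 0 := mul_neg_of_neg_of_pos hneg' (norm_pos_iff.2 hφ)
        linarith [norm_nonneg (B φ - A φ)]
      exact mul_nonneg this (norm_nonneg _)
  rcases hδ with hδ | hφ
  swap
  · subst hφ; simp
  have he : ∀ j, ‖e j‖ ≤ 2 * δ * ‖φ‖ := by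
    intro j
    match j with
    | 0 => simp only [he_def, norm_zero]; linarith
    | 1 =>
      simp only [he_def]
      linarith [hAB φ]
    | (j + 2) =>
      simp only [he_def]
      rw [norm_smul, Real.norm_eq_abs, abs_two]
      have h1 := hAB (u (j + 1))
      have h2 : ‖u (j + 1)‖ ≤ ‖φ‖ := by simpa [hu] using hB (j + 1) φ
      have h3 : δ * ‖u (j + 1)‖ ≤ δ * ‖φ‖ := by
        rcases eq_or_lt_of_le (norm_nonneg φ) with h0 | h0
        · have : φ = 0 := norm_eq_zero.1 h0.symm
          subst this; simp [hu] at h2 ⊢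
        · exact mul_le_mul_of_nonneg_left h2 (by nlinarith [norm_nonneg φ])
      linarith
  have key := norm_sub_le_of_rec_of_uniform A hA (φ := φ) (e := e) (t := fun k => aeval A (Chebyshev.T ℝ k) φ) (s := u)
    (by simp) (by simp) (fun k => aeval_T_add_two_apply A φ k) (by simp [hu]) (by simp [hu, he_def])
    (fun k => by
      simp only [hu, he_def]
      rw [aeval_T_add_two_apply B φ k, smul_sub]
      abel) he k
  calc ‖aeval B (Chebyshev.T ℝ k) φ - aeval A (Chebyshev.T ℝ k) φ‖ = ‖u k - aeval A (Chebyshev.T ℝ k) φ‖ := rfl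
    _ ≤ 2 * δ * ‖φ‖ * ((k : ℝ) * (k + 1) / 2) := key
    _ = δ * ((k : ℝ) * (k + 1)) * ‖φ‖ := by ring

/-- ★ The Chebyshev-sum version: `‖Σ_{k≤K} c_k T_k(B)φ − Σ_{k≤K} c_k T_k(A)φ‖ ≤ δ‖φ‖ · Σ_{k≤K} |c_k| k(k+1)` — the x2r method note's
table-rounding term with `δ = ‖ŝ − s‖ = 2‖ŷ − y‖`. [cite: DLMF, 3.11(ii)] -/
theorem norm_chebSum_aeval_sub_le (A B : Module.End ℝ E)
    (hA : ∀ (m : ℕ) (v : E), ‖aeval A (Chebyshev.T ℝ m) v‖ ≤ ‖v‖) (hB : ∀ (m : ℕ) (v : E), ‖aeval B (Chebyshev.T ℝ m) v‖ ≤ ‖v‖)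
    {δ : ℝ} (hAB : ∀ v, ‖B v - A v‖ ≤ δ * ‖v‖) (φ : E) (c : ℕ → ℝ) (K : ℕ) :
    ‖∑ k ∈ range (K + 1), c k • aeval B (Chebyshev.T ℝ k) φ - ∑ k ∈ range (K + 1), c k • aeval A (Chebyshev.T ℝ k) φ‖
      ≤ δ * ‖φ‖ * ∑ k ∈ range (K + 1), |c k| * ((k : ℝ) * (k + 1)) := by
  rw [← sum_sub_distrib, mul_sum]
  refine (norm_sum_le _ _).trans (sum_le_sum fun k _ => ?_)
  rw [← smul_sub, norm_smul, Real.norm_eq_abs]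
  calc |c k| * ‖aeval B (Chebyshev.T ℝ k) φ - aeval A (Chebyshev.T ℝ k) φ‖ ≤ |c k| * (δ * ((k : ℝ) * (k + 1)) * ‖φ‖) :=
        mul_le_mul_of_nonneg_left (norm_aeval_T_sub_aeval_T_le A B hA hB hAB φ k) (abs_nonneg _)
    _ = δ * ‖φ‖ * (|c k| * ((k : ℝ) * (k + 1))) := by ring

end Normed

section Symmetric

variable {E : Type*} [NormedAddCommGroup E] [InnerProductSpace ℝ E] [FiniteDimensional ℝ E]

/-- Symmetric-contraction instance: `A`, `B` symmetric with `‖A v‖, ‖B v‖ ≤ ‖v‖` and `‖B v − A v‖ ≤ δ‖v‖` ⇒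
`‖T_k(B)φ − T_k(A)φ‖ ≤ δ·k(k+1)·‖φ‖`. [cite: DLMF, 3.11(ii)] -/
theorem norm_aeval_T_sub_aeval_T_le_of_isSymmetric {A B : E →ₗ[ℝ] E} (hA : A.IsSymmetric) (hB : B.IsSymmetric)
    (hAc : ∀ v, ‖A v‖ ≤ ‖v‖) (hBc : ∀ v, ‖B v‖ ≤ ‖v‖) {δ : ℝ} (hAB : ∀ v, ‖B v - A v‖ ≤ δ * ‖v‖) (φ : E) (k : ℕ) :
    ‖aeval B (Chebyshev.T ℝ k) φ - aeval A (Chebyshev.T ℝ k) φ‖ ≤ δ * ((k : ℝ) * (k + 1)) * ‖φ‖ :=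
  norm_aeval_T_sub_aeval_T_le A B (fun m v => norm_aeval_T_le_of_isSymmetric hA hAc m v)
    (fun m v => norm_aeval_T_le_of_isSymmetric hB hBc m v) hAB φ k

/-- Symmetric-contraction instance of the Chebyshev-sum bound. [cite: DLMF, 3.11(ii)] -/
theorem norm_chebSum_aeval_sub_le_of_isSymmetric {A B : E →ₗ[ℝ] E} (hA : A.IsSymmetric) (hB : B.IsSymmetric)
    (hAc : ∀ v, ‖A v‖ ≤ ‖v‖) (hBc : ∀ v, ‖B v‖ ≤ ‖v‖) {δ : ℝ} (hAB : ∀ v, ‖B v - A v‖ ≤ δ * ‖v‖) (φ : E)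
    (c : ℕ → ℝ) (K : ℕ) :
    ‖∑ k ∈ range (K + 1), c k • aeval B (Chebyshev.T ℝ k) φ - ∑ k ∈ range (K + 1), c k • aeval A (Chebyshev.T ℝ k) φ‖
      ≤ δ * ‖φ‖ * ∑ k ∈ range (K + 1), |c k| * ((k : ℝ) * (k + 1)) :=
  norm_chebSum_aeval_sub_le A B (fun m v => norm_aeval_T_le_of_isSymmetric hA hAc m v)
    (fun m v => norm_aeval_T_le_of_isSymmetric hB hBc m v) hAB φ c K

end Symmetric

end Summit.Ventures.YMGap.FlowData.ChebyshevRecurrenceStability
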